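import Summits.ABC.IUTFork.Cor312SettingDHVol
import Summits.ABC.IUTFork.Thm311RealDegreeFull
import HarnessLib

/-!
# [IUTchIII] Corollary 3.12, statement — the `Cor312.Setting` over the REAL log-shells with the PACKET-NORMALISED
# (probability-weighted) verbatim volumes: `hadm`, `hul_nonempty` and c312-6's `BridgeHyps` fields PROVED

Record file (D-0012) of the abc-iut cell (Cor. 3.12 sub-crew, seat abc-iut-c312-1 — the typer of [IUTchIII]
Thm. 3.11 —, gen 5); TAKES NO SIDE on [IUTchIII] Cor. 3.12. abc-iut-c312-5's / abc-iut-c312-3's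
`Cor312SettingDHVol` builds c312-7's `Cor312.Setting.ofComparison` (the setting of the printed statement of
[IUTchIII] Cor. 3.12, kurims `paper:url-4b091feeb646` p. 173 l. 41 – p. 174 l. 19) over `Real.situationDHVol` — the real
Dupuy–Hilado-level log-shells of the number field `F` WITH the verbatim container `Real.summandPiecesDH` — from the
field-factor pieces `factorIdxDH`/`factorFieldDH`/`factorMapDH` (c312-3's decompositions
`ψ_{v⃗} : F_{v_0} ⊗_{ℚ_p} ⋯ ⊗_{ℚ_p} F_{v_j} ≃ Π_i L_{v⃗,i}`; no factor at `∞`). That container's weights are not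
packet-normalised (this seat's finding F-c312-1-g5-1, kernel certificate `Real.logvol_p_mul_DH` in
`Thm311RealDegreeFull`: at `(j, p)` every log-volume is print's times `(|𝕍(F)_p|/[F:ℚ])^{j+1}`). THIS file is the
TWIN over the probability-weighted container `Real.summandPiecesPr` (`Thm311RealDegree`, p417577: c312-5's
`padicPresentationDH` with the weight `Pr(v⃗) = Π_a n_{v_a}/[F:ℚ]^{j+1}`; packet-normalisation `Real.logvol_p_mul_Pr`):

* `Real.situationPrVol` — c312-5's `Situation.ofShells` over `logShellsDH X logv` with `Adm`/`logvol` :=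
  `summandPiecesPr` (the remaining binders as in `situationDHVol`);
* `Real.realPiecesPr` — the SAME field-factor pieces (`factorIdxDH`, `factorFieldDH`, `factorMapDH`: the summands,
  their decompositions and the comparison do not depend on the weights) as `Setting.RealPieces` of `situationPrVol`;
* `Real.hadm_Pr` — hull-set preimages are admissible (c312-5's generic `PadicPresentation.adm_preimage_of_isHullSet`
  at the probability-weighted presentation; admissibility is weight-free), `Real.settingPrVol` :=
  `Setting.ofComparison` over `situationPrVol`, `settingPrVol_n`, `hul_nonempty_settingPrVol`, and
  `bridgeHyps_settingPrVol` — c312-6's `BridgeHyps` with `mono`, `image_adm`, `image_fin`, `hul_nonempty`,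
  `theta_nonempty` DISCHARGED (`Real.bridgeHyps_Pr`), leaving exactly the inputs left by `bridgeHyps_settingDHVol`:
  admissibility of the (Ind3)-enlarged Θ-region at the labels `j ∈ 𝔽_l^⋇` with finitely supported log-volume, and
  `ThetaFinite`.

So every theorem the cell proved «at the assembled real setting with the verbatim volumes» (`settingDHVol`) has a
packet-normalised counterpart by substituting `situationDHVol ↦ situationPrVol`, `settingDHVol ↦ settingPrVol`,
`bridgeHyps_settingDHVol ↦ bridgeHyps_settingPrVol` (abc-iut-c312-12's `Cor312TeamBCapstoneRealDH`, abc-iut-c312-6's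
staged `Cor312SettingDHVolRoute`/`…Finite` are generic in these names' types). [claim: Mochizuki2012, status: disputed]
for the quoted setting; [cite: DupuyHilado2025, §3.6, Def. 3.6.1]; [cite: Mochizuki2012, IUTchIV Prop. 1.4 (i) p. 13].
HONEST FRAMING: bookkeeping at the real carriers; no edit to c312-5's / c312-3's / c312-7's files; nothing here
bears on the truth of [IUTchIII] Cor. 3.12. typed ≠ proved; instantiated ≠ endorsed.
-/

noncomputable section

open Set Function NumberField IsDedekindDomain
open scoped Pointwise

namespace Summit.ABC.IUTFork.Thm311.Real

open Cor312 Cor312Vol Literature.IUT.LogThetaLattice Literature.IUT.LogVolume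

variable {F : Type} [Field F] [NumberField F] (X : PilotData F) {logv : PadicLogs F} (hlog : LogvAnalytic logv)

/-- The probability-weighted `p`-adic presentation at the prime `pp` (`Thm311RealDegree`), `Fact` instance supplied.
[folklore] -/
abbrev presAtPr (pp : Nat.Primes) :
    haveI : Fact (pp : ℕ).Prime := ⟨pp.2⟩
    PadicPresentation (logShellsDH X logv) (.inr pp) pp.1 :=
  haveI : Fact (pp : ℕ).Prime := ⟨pp.2⟩
  padicPresentationPr X pp.1 logv (hlog pp)

section Setting

variable (M : Type) [Field M] [NumberField M]
  (archPk : ∀ (j : (thetaIndex X).Label) (vQ : (thetaIndex X).VQ), Set ((logShellsDH X logv).Packet j vQ))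
  (archSub : ∀ (j : (thetaIndex X).Label) (v : (thetaIndex X).V),
    Set ((logShellsDH X logv).Packet j ((thetaIndex X).over v)))
  (Ψ : ℤ → ∀ v : (thetaIndex X).V, v ∈ (thetaIndex X).Vbad → Set ((logShellsDH X logv).StarPacket v))
  (act : ℤ → ∀ v : (thetaIndex X).V, v ∈ (thetaIndex X).Vbad →
    (logShellsDH X logv).StarPacket v → Module.End ℚ ((logShellsDH X logv).StarPacket v))
  (Mmod : ℤ → ∀ j : (thetaIndex X).LabelStar, Set ((logShellsDH X logv).GlobalPacket j.1))
  (region : ℤ → ∀ j : (thetaIndex X).LabelStar, FinDivisor M → ∀ vQ : (thetaIndex X).VQ,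
    Set ((logShellsDH X logv).Packet j.1 vQ))

/-- **The situation of Thm. 3.11 over the real Dupuy–Hilado-level log-shells WITH THE PACKET-NORMALISED VERBATIM
VOLUMES**: c312-5's `Situation.ofShells` with `Adm`, `logvol` := the probability-weighted container `summandPiecesPr`
(twin of c312-5's `situationDHVol`; remaining binders: archimedean integral structures, (b), (c) data).
[claim: Mochizuki2012, status: disputed] -/
abbrev situationPrVol : Situation (thetaIndex X) :=
  Situation.ofShells (logShellsDH X logv) M archPk archSub (summandPiecesPr X hlog).Adm
    (summandPiecesPr X hlog).logvol Ψ act Mmod region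

/-- Every line of `situationPrVol` carries the probability-weighted container. [folklore] -/
theorem realizes_situationPrVol (n : ℤ) :
    (summandPiecesPr X hlog).Realizes ((situationPrVol X hlog M archPk archSub Ψ act Mmod region).D n) :=
  realizes_ofShells_Pr X hlog M archPk archSub Ψ act Mmod region n

/-- **The real field-factor pieces** of the setting over `situationPrVol`: c312-5's / c312-3's factors
`factorIdxDH`/`factorFieldDH` and comparison `factorMapDH` (the summands `F_{v_0} ⊗_{ℚ_p} ⋯ ⊗_{ℚ_p} F_{v_j}`, their
decompositions `ψ_{v⃗}` and the comparison `e` are the SAME for both weightings) and the two pilot binders.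
[claim: Mochizuki2012, status: disputed] -/
def realPiecesPr {ObLgp ObΔ : Type}
    (thetaBox : ℤ → ObLgp → ∀ (j : (thetaIndex X).Label) (vQ : (thetaIndex X).VQ),
      Set (∀ s : factorIdxDH X hlog j vQ, factorFieldDH X hlog j vQ s))
    (qCentre : ObΔ → ∀ (j : (thetaIndex X).Label) (vQ : (thetaIndex X).VQ),
      ∀ s : factorIdxDH X hlog j vQ, factorFieldDH X hlog j vQ s) :
    Setting.RealPieces (situationPrVol X hlog M archPk archSub Ψ act Mmod region) ObLgp ObΔ where
  J := factorIdxDH X hlog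
  instFintype := factorIdxDH_fintype X hlog
  K := factorFieldDH X hlog
  instField := factorFieldDH_field X hlog
  instUltra := factorFieldDH_ultra X hlog
  instProper := factorFieldDH_proper X hlog
  e := factorMapDH X hlog
  thetaBox := thetaBox
  qCentre := qCentre

/-- **`hadm` DISCHARGED for the packet-normalised volumes**: the preimage of every hull-set `λ·𝒪_L` of every real
packet is an admissible region of every line of `situationPrVol` ([IUTchIII] Rmk. 3.9.5 (ii) "`λ·𝒪 ∈ 𝕄(𝓘^ℚ(−))`"; at a
prime by c312-5's generic `adm_preimage_of_isHullSet` — admissibility does not read the weights —, at `∞` trivially).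
[claim: Mochizuki2012, status: disputed] -/
theorem hadm_Pr (n : ℤ) : ∀ (j : (thetaIndex X).Label) (vQ : (thetaIndex X).VQ)
    (H : Set (∀ s : factorIdxDH X hlog j vQ, factorFieldDH X hlog j vQ s)),
    IsHullSet (factorFieldDH X hlog j vQ) H →
      ((situationPrVol X hlog M archPk archSub Ψ act Mmod region).D n).Adm j vQ (factorMapDH X hlog j vQ ⁻¹' H)
  | j, .inl u, H, hH => by
    refine (LocalPieces.adm_trivial_iff (logShellsDH X logv) (.inl u) j _).2 ⟨0, ?_⟩
    obtain ⟨c, -, rfl⟩ := hH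
    show factorMapDH X hlog j (.inl u) 0 ∈ hullSet _ c
    rw [hullSet, mem_polydisc]
    exact fun s => s.elim
  | j, .inr pp, H, hH => by
    haveI : Fact (pp : ℕ).Prime := ⟨pp.2⟩
    exact (presAtPr X hlog pp).adm_preimage_of_isHullSet j hH

variable (n : ℤ) {HT : Type} {LogLink : HT → HT → Type} {IsFull : ∀ {s t : HT}, LogLink s t → Prop}
  (lat : LGPGaussianLogThetaLattice LogLink IsFull)
  {Frd : Type} {IsoF : Frd → Frd → Type} {Ob : Frd → Type} {realify : Frd → Frd} {Strip : Type}
  {IsoS : Strip → Strip → Type} {Mv : ∀ v : (thetaIndex X).V, v ∈ (thetaIndex X).Vbad → Type}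
  [∀ v h, Monoid (Mv v h)]
  (sig : GlobalLGPFrobenioidSignature (thetaIndex X).lstar (thetaIndex X).V (· ∈ (thetaIndex X).Vbad)
    Frd IsoF Ob realify Strip IsoS Mv)
  (split : SplittingMonoids Mv) {ObΔ : Type} {N : ∀ v : (thetaIndex X).V, v ∈ (thetaIndex X).Vbad → Type}
  [∀ v h, Monoid (N v h)] (qData : QPilotData ObΔ N)
  (thetaBox : ℤ → Ob sig.Clgp → ∀ (j : (thetaIndex X).Label) (vQ : (thetaIndex X).VQ),
    Set (∀ s : factorIdxDH X hlog j vQ, factorFieldDH X hlog j vQ s))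
  (qCentre : ObΔ → ∀ (j : (thetaIndex X).Label) (vQ : (thetaIndex X).VQ),
    ∀ s : factorIdxDH X hlog j vQ, factorFieldDH X hlog j vQ s)
  (hq : ∀ j vQ s, qCentre (qPilotObject qData) j vQ s ≠ 0)
  (hfin : ∀ j : (thetaIndex X).Label, (Function.support fun vQ =>
    ((situationPrVol X hlog M archPk archSub Ψ act Mmod region).D n).logvol j vQ
      (factorMapDH X hlog j vQ ⁻¹' hullSet (factorFieldDH X hlog j vQ) (qCentre (qPilotObject qData) j vQ))).Finite)

/-- **The setting of [IUTchIII] Cor. 3.12 over the REAL log-shells of `F` with the PACKET-NORMALISED verbatim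
volumes** (c312-7's `Setting.ofComparison` at `situationPrVol` with the real field-factor pieces; `hadm` PROVED) —
the twin of c312-5's `settingDHVol`. Binders left: the column `n`, the context data `lat`/`sig`/`split`/`qData`,
the Θ-boxes, the `q`-centre with `hq`, `hfin`, and the situation's archimedean integral structures and (b)(c) data.
[claim: Mochizuki2012, status: disputed] -/
def settingPrVol : Cor312.Setting (situationPrVol X hlog M archPk archSub Ψ act Mmod region) :=
  Setting.ofComparison n lat sig split qData (realPiecesPr X hlog M archPk archSub Ψ act Mmod region thetaBox qCentre)
    hq (hadm_Pr X hlog M archPk archSub Ψ act Mmod region n) hfin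

/-- The column of the assembled setting is `n`. [folklore] -/
theorem settingPrVol_n :
    (settingPrVol X hlog M archPk archSub Ψ act Mmod region n lat sig split qData thetaBox qCentre hq hfin).n = n :=
  rfl

/-- **`hul_nonempty` DISCHARGED**: every hull-set of every frame of the assembled setting is nonempty (it is an
admissible region of the container). [folklore] -/
theorem hul_nonempty_settingPrVol (j : (thetaIndex X).Label) (vQ : (thetaIndex X).VQ) :
    ∀ H ∈ ((settingPrVol X hlog M archPk archSub Ψ act Mmod region n lat sig split qData thetaBox qCentre hq
      hfin).frame j vQ).Hul, H.Nonempty := by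
  rintro _ ⟨H', hH', rfl⟩
  have h := hadm_Pr X hlog M archPk archSub Ψ act Mmod region n j vQ H' hH'
  exact SummandPieces.Adm.nonempty ((realizes_situationPrVol X hlog M archPk archSub Ψ act Mmod region n).adm_iff
    j vQ _ |>.1 h)

/-- **c312-6's `BridgeHyps` for the real setting with the packet-normalised verbatim volumes**, with `mono`,
`image_adm`, `image_fin`, `hul_nonempty`, `theta_nonempty` DISCHARGED (`Real.bridgeHyps_Pr`): it remains to supply
admissibility of the (Ind3)-enlarged Θ-region at the labels `j ∈ 𝔽_l^⋇` (a property of the binder `thetaBox`; owner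
c312-3 `Ind3Datum`) with finitely supported log-volume, and `ThetaFinite` (c312-7 `hullDefined_of_stable`) — exactly
the residual list of c312-5's `bridgeHyps_settingDHVol`. [claim: Mochizuki2012, status: disputed] -/
theorem bridgeHyps_settingPrVol
    (hθ : ∀ (i : Fin (thetaIndex X).lstar) (vQ : (thetaIndex X).VQ),
      ((situationPrVol X hlog M archPk archSub Ψ act Mmod region).D n).Adm _ vQ
        ((settingPrVol X hlog M archPk archSub Ψ act Mmod region n lat sig split qData thetaBox qCentre hq
          hfin).thetaRegion3 (Setting.labelSucc i) vQ))
    (hfinθ : ∀ i : Fin (thetaIndex X).lstar, (Function.support fun vQ : (thetaIndex X).VQ =>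
      ((situationPrVol X hlog M archPk archSub Ψ act Mmod region).D n).logvol _ vQ
        ((settingPrVol X hlog M archPk archSub Ψ act Mmod region n lat sig split qData thetaBox qCentre hq
          hfin).thetaRegion3 (Setting.labelSucc i) vQ)).Finite)
    (finite : (settingPrVol X hlog M archPk archSub Ψ act Mmod region n lat sig split qData thetaBox qCentre hq
      hfin).ThetaFinite) :
    BridgeHyps (settingPrVol X hlog M archPk archSub Ψ act Mmod region n lat sig split qData thetaBox qCentre hq
      hfin) :=
  bridgeHyps_Pr X hlog M archPk archSub Ψ act Mmod region _ hθ hfinθ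
    (hul_nonempty_settingPrVol X hlog M archPk archSub Ψ act Mmod region n lat sig split qData thetaBox qCentre hq
      hfin) finite

end Setting

end Summit.ABC.IUTFork.Thm311.Real

end
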